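import Summits.QuantumFields.QCD.Theses.QuarksAsStableAction
import Literature.MathematicalPhysics.QuantumLattice.WilsonDiracAP

/-!
# Time-slicing of the `r = 1` Wilson–Dirac matrix
(helper for crux stmt-QuantumFields-9737, line `Sketch` — F3-core STEP β, registered stub
`wilsonDirac_submatrix_timeSlice` of the lead's skeleton `work/StableActionBridge.lean`)

Splitting the Euclidean time coordinate (direction `0`) off the four-torus site, `x = Fin.cons t y` with
`t : ZMod L` and `y : (ℤ/L)³`, exhibits the tree's `r = 1` Wilson–Dirac matrix `wilsonDirac ρ U m 1`
(Montvay–Münster (4.85) at `a = 1`, colour-gauged) as a Wilson-type projector chain in time: reindexed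
by `(t, (y, a, α)) ↦ ((t, y), a, α)` it is the block matrix whose `(t, s)` block is

* the same-time slice operator `A_t` (mass diagonal `m + 4` plus the spatial Wilson hops of slice `t`,
  directions `μ = j.succ`, `j : Fin 3`) for `s = t`,
* the forward temporal hop `−P⁻ ⊗ ρ(U((t,y),0))` for `s = t + 1`,
* the backward temporal hop `−P⁺ ⊗ ρ(U((s,y),0))⁻¹` for `t = s + 1`,

with the spin projectors `P± = ½(1 ± γ₀)`; the three cases are kept as separate summands (they overlap
when `L ≤ 2`, where the identity still holds summand by summand).  This is the input of the time-slice /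
transfer-matrix reduction of the fermion determinant (`det_projChain`).
[cite: Luscher1977, pp. 283–292]; [cite: MontvayMunster1994, §4.2 (4.85)].

Proof: entrywise, unfold `wilsonDirac`, split `∑ μ : Fin 4` into `μ = 0` and `μ = j.succ`
(`Fin.sum_univ_succ`), and rewrite the hop conditions through the time splitting:
`(t, y) + ê₀ = (t + 1, y)` (`shift_cons_zero`), `(t, y) + ê_{j+1} = (t, y + ê_j)` (`shift_cons_succ`),
`Fin.cons` injective; the Kronecker products `P∓ · W` collapse to `δ_{yy'} (P∓)_{αβ} ρ(U)_{ab}`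
(`spinLift_mul_colourLift`).  Pure theorem file (no definitions).
-/

noncomputable section

namespace Summit.QuantumFields.QCD.Cruxes.StableActionBridge.Sketch

open Literature.MathematicalPhysics.QuantumLattice Literature.MathematicalPhysics.QuantumFieldTheory

namespace TimeSlice

open Literature.Probability.LatticeModels (TorusSite)

variable {L : ℕ}

/-- Splitting off the time coordinate commutes with the time shift: `(t, y) + ê₀ = (t + 1, y)`. -/
theorem shift_cons_zero (t : ZMod L) (y : TorusSite 3 L) :
    Site.shift (Fin.cons t y : TorusSite 4 L) 0 = Fin.cons (t + 1) y := by
  funext i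
  refine Fin.cases ?_ (fun j => ?_) i
  · simp [Site.shift]
  · simp [Site.shift, Fin.succ_ne_zero]

/-- Splitting off the time coordinate turns the spatial shifts of the four-torus into those of the
three-torus: `(t, y) + ê_{j+1} = (t, y + ê_j)`. -/
theorem shift_cons_succ (t : ZMod L) (y : TorusSite 3 L) (j : Fin 3) :
    Site.shift (Fin.cons t y : TorusSite 4 L) j.succ = Fin.cons t (Site.shift y j) := by
  funext i
  refine Fin.cases ?_ (fun k => ?_) i
  · simp [Site.shift, (Fin.succ_ne_zero j).symm]
  · simp [Site.shift, Pi.single_apply, Fin.succ_inj]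

/-- Product of a spin-only block-diagonal matrix `1 ⊗ 1 ⊗ S` with a colour-only one
`y ↦ 1_y ⊗ C(y) ⊗ 1` on `X × Y × Z` (site × colour × spin): the Kronecker sum collapses to
`δ_{x x'} S_{αβ} C(x)_{ab}`. -/
theorem spinLift_mul_colourLift {X Y Z : Type*} [Fintype X] [Fintype Y] [Fintype Z] [DecidableEq X]
    [DecidableEq Y] [DecidableEq Z] (S : Matrix Z Z ℂ) (C : X → Matrix Y Y ℂ) :
    (Matrix.of fun a b : X × Y × Z => if a.1 = b.1 ∧ a.2.1 = b.2.1 then S a.2.2 b.2.2 else 0) *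
        (Matrix.of fun a b : X × Y × Z => if a.1 = b.1 ∧ a.2.2 = b.2.2 then C a.1 a.2.1 b.2.1 else 0) =
      Matrix.of fun a b : X × Y × Z => if a.1 = b.1 then S a.2.2 b.2.2 * C a.1 a.2.1 b.2.1 else 0 := by
  ext a b
  rw [Matrix.mul_apply, Finset.sum_eq_single (a.1, a.2.1, b.2.2)]
  · simp only [Matrix.of_apply, and_self, and_true, if_true]
    split_ifs <;> simp
  · rintro ⟨x, y, z⟩ - hne
    simp only [Matrix.of_apply]
    split_ifs with h1 h2
    · exact absurd (by rw [h1.1, h1.2, ← h2.2]) hne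
    all_goals simp
  · exact fun h => absurd (Finset.mem_univ _) h

end TimeSlice

open Literature.Probability.LatticeModels (TorusSite)

/-- **Time-slicing of the Wilson–Dirac matrix** (stub `wilsonDirac_submatrix_timeSlice` of line `Sketch`,
F3-core STEP β).  Reindexing the four-torus site as `x = Fin.cons t y` (time `t`, spatial site `y`), the
`r = 1` Wilson–Dirac matrix is the projector chain with same-time blocks `A_t` (mass + spatial Wilson hops
of slice `t`), forward temporal hop `−(P⁻ ⊗ 1)·W_t` to slice `t + 1` and backward hop `−(P⁺ ⊗ 1)·W'_s`
from slice `s + 1` to `s`, where `P± = ½(1 ± γ₀)`, `W_t = 1 ⊗ ρ(U((t,·),0)) ⊗ 1`,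
`W'_s = 1 ⊗ ρ(U((s,·),0))⁻¹ ⊗ 1`; valid for every `L ≥ 1`. -/
theorem wilsonDirac_submatrix_timeSlice :
    ∀ (Nc L : ℕ) [NeZero L] (G : Type) [Group G] (ρ : G →* Matrix (Fin Nc) (Fin Nc) ℂ)
      (U : GaugeConfig 4 L G) (m : ℝ),
      let Pp : Matrix (TorusSite 3 L × Fin Nc × Fin 4) (TorusSite 3 L × Fin Nc × Fin 4) ℂ := Matrix.of fun a b =>
        if a.1 = b.1 ∧ a.2.1 = b.2.1 then ((1 / 2 : ℂ) • (1 + euclideanGamma 0)) a.2.2 b.2.2 else 0;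
      let Pm : Matrix (TorusSite 3 L × Fin Nc × Fin 4) (TorusSite 3 L × Fin Nc × Fin 4) ℂ := Matrix.of fun a b =>
        if a.1 = b.1 ∧ a.2.1 = b.2.1 then ((1 / 2 : ℂ) • (1 - euclideanGamma 0)) a.2.2 b.2.2 else 0;
      let W : ZMod L → Matrix (TorusSite 3 L × Fin Nc × Fin 4) (TorusSite 3 L × Fin Nc × Fin 4) ℂ := fun t =>
        Matrix.of fun a b => if a.1 = b.1 ∧ a.2.2 = b.2.2 then
          ρ (U ((Fin.cons t a.1 : TorusSite 4 L), 0)) a.2.1 b.2.1 else 0;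
      let W' : ZMod L → Matrix (TorusSite 3 L × Fin Nc × Fin 4) (TorusSite 3 L × Fin Nc × Fin 4) ℂ := fun t =>
        Matrix.of fun a b => if a.1 = b.1 ∧ a.2.2 = b.2.2 then
          ρ (U ((Fin.cons t a.1 : TorusSite 4 L), 0))⁻¹ a.2.1 b.2.1 else 0;
      let A : ZMod L → Matrix (TorusSite 3 L × Fin Nc × Fin 4) (TorusSite 3 L × Fin Nc × Fin 4) ℂ := fun t =>
        Matrix.of fun a b =>
          (if a = b then ((m + 4 * 1 : ℝ) : ℂ) else 0) -
            (1 / 2 : ℂ) * ∑ j : Fin 3,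
              ((if b.1 = Literature.MathematicalPhysics.QuantumFieldTheory.Site.shift a.1 j then
                  (((1 : ℝ) : ℂ) • (1 : Matrix (Fin 4) (Fin 4) ℂ) - euclideanGamma j.succ) a.2.2 b.2.2 *
                    ρ (U ((Fin.cons t a.1 : TorusSite 4 L), j.succ)) a.2.1 b.2.1 else 0) +
                (if a.1 = Literature.MathematicalPhysics.QuantumFieldTheory.Site.shift b.1 j then
                  (((1 : ℝ) : ℂ) • (1 : Matrix (Fin 4) (Fin 4) ℂ) + euclideanGamma j.succ) a.2.2 b.2.2 *
                    ρ (U ((Fin.cons t b.1 : TorusSite 4 L), j.succ))⁻¹ a.2.1 b.2.1 else 0));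
      (wilsonDirac ρ U m 1).submatrix
          (fun p : ZMod L × (TorusSite 3 L × Fin Nc × Fin 4) => ((Fin.cons p.1 p.2.1 : TorusSite 4 L), p.2.2))
          (fun p : ZMod L × (TorusSite 3 L × Fin Nc × Fin 4) => ((Fin.cons p.1 p.2.1 : TorusSite 4 L), p.2.2)) =
        Matrix.of fun p q : ZMod L × (TorusSite 3 L × Fin Nc × Fin 4) =>
          (if q.1 = p.1 then A p.1 p.2 q.2 else 0) - (if q.1 = p.1 + 1 then (Pm * W p.1) p.2 q.2 else 0) -
            (if p.1 = q.1 + 1 then (Pp * W' q.1) p.2 q.2 else 0) := by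
  intro Nc L _ G _ ρ U m Pp Pm W W' A
  ext ⟨t, y, a, α⟩ ⟨s, z, b, β⟩
  -- the Kronecker products `P∓ · W` collapse to `δ_{yy'} (P∓)_{αβ} ρ(U)_{ab}`
  have hPmW : ∀ t, Pm * W t = Matrix.of fun a b : TorusSite 3 L × Fin Nc × Fin 4 => if a.1 = b.1 then
      ((1 / 2 : ℂ) • (1 - euclideanGamma 0)) a.2.2 b.2.2 * ρ (U ((Fin.cons t a.1 : TorusSite 4 L), 0)) a.2.1 b.2.1
        else 0 :=
    fun t => TimeSlice.spinLift_mul_colourLift _ (fun x => ρ (U ((Fin.cons t x : TorusSite 4 L), 0)))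
  have hPpW' : ∀ t, Pp * W' t = Matrix.of fun a b : TorusSite 3 L × Fin Nc × Fin 4 => if a.1 = b.1 then
      ((1 / 2 : ℂ) • (1 + euclideanGamma 0)) a.2.2 b.2.2 * ρ (U ((Fin.cons t a.1 : TorusSite 4 L), 0))⁻¹ a.2.1 b.2.1
        else 0 :=
    fun t => TimeSlice.spinLift_mul_colourLift _ (fun x => ρ (U ((Fin.cons t x : TorusSite 4 L), 0))⁻¹)
  simp only [Matrix.submatrix_apply, Matrix.of_apply, hPmW, hPpW', A]
  -- unfold `D_W`, split `∑ μ : Fin 4` as `μ = 0` plus `μ = j.succ`, and push the time splitting through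
  -- the hop conditions
  simp only [wilsonDirac, Matrix.of_apply]
  rw [Fin.sum_univ_succ]
  simp only [TimeSlice.shift_cons_zero, TimeSlice.shift_cons_succ, Fin.cons_inj, Prod.mk.injEq]
  -- summand-by-summand identification (no exclusivity of the three time conditions is used)
  by_cases hst : s = t
  · subst hst
    by_cases hyz : y = z
    · subst hyz
      simp only [true_and, and_true, if_true, Matrix.smul_apply, smul_eq_mul, Complex.ofReal_one, one_smul]
      split_ifs <;> ring
    · simp only [hyz, Ne.symm hyz, true_and, false_and, and_false, if_true, if_false, Matrix.smul_apply,
        smul_eq_mul, Complex.ofReal_one, one_smul]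
      split_ifs <;> ring
  · by_cases hyz : y = z
    · subst hyz
      simp only [hst, Ne.symm hst, true_and, and_true, false_and, if_true, if_false, Matrix.smul_apply,
        smul_eq_mul, Complex.ofReal_one, one_smul, add_zero, Finset.sum_const_zero]
      split_ifs <;> ring
    · simp only [hst, Ne.symm hst, hyz, Ne.symm hyz, false_and, and_false, if_false, Matrix.smul_apply,
        smul_eq_mul, Complex.ofReal_one, one_smul, add_zero, Finset.sum_const_zero]
      split_ifs <;> ring

end Summit.QuantumFields.QCD.Cruxes.StableActionBridge.Sketch

end
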